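import Mathlib.LinearAlgebra.Eigenspace.Minpoly
import Mathlib.Algebra.Module.Torsion.Basic
import Mathlib.LinearAlgebra.Basis.Basic
import Mathlib.RingTheory.Ideal.Quotient.Operations
import Mathlib.SetTheory.Cardinal.Finite
import Mathlib.GroupTheory.Coset.Card
import HarnessLib

/-!
# Counting eigenvectors of an endomorphism killed by a polynomial: `#{w : φ w = μ w} ≤ #(S/(Δ))^{rank}` (proofs)

`Proofs` file (theorems only; no definition, no named fact, no instance) in topic `Algebra/Module`; elementary
counting used by the cell `pub/bsd-print-x9` to bound the local invariants `H⁰(K_v, E[p^j] ⊗ A_{m,j}(ψ))` of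
Howard's Eisenstein levels uniformly in the level (hypothesis H.4 of [Howard 2004] at the places `v ∣ N`).

Let `A` be a commutative ring, `W` an `A`-module, `φ ∈ End_A(W)` with `P(φ) = 0` for a polynomial `P ∈ A[X]`.

* §1 `eval_smul_eq_zero_of_aeval_eq_zero` — an eigenvector `φ w = μ w` is killed by `P(μ)` (Mathlib's
  `Module.End.aeval_apply_of_mem_apply_eq_smul`); so the `μ`-eigenvectors lie in the `P(μ)`-torsion `W[P(μ)]`.
* §2 `natCard_torsionBy_eq_pow` — for `W` free with a finite basis indexed by `ι`, `#W[δ] = #A[δ]^{#ι}`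
  (coordinates), and `natCard_setOf_apply_eq_smul_le_pow`: **`#{w : φ w = μ w} ≤ #A[P(μ)]^{#ι}`**.
* §3 `natCard_torsionBy_eq_natCard_quotient_span` — for a FINITE ring, `#A[δ] = #(A/(δ))` (kernel and cokernel of
  multiplication by `δ` have the same size), and `natCard_quotient_span_map_le` — along a surjection `f : S ↠ A`,
  `#(A/(f Δ)) ≤ #(S/(Δ))` when `S/(Δ)` is finite; the same kernel/cokernel count for an endomorphism of a finite
  module, `natCard_quotient_range_eq_natCard_ker`.
* §4 **`natCard_setOf_apply_eq_smul_le_of_surjective`** — assembled: `#{w : φ w = μ w} ≤ #(S/(Δ))^{#ι}` whenever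
  `f Δ = P(μ)` for a surjection `f : S ↠ A` of commutative rings with `S/(Δ)` finite and `A` finite.

(In the application `A = A_{m,j} = Λ/(T^m + p, p^j)`, `S = S_m = Λ/(T^m + p)` a DVR, `W = E[p^j] ⊗ A_{m,j}` free of
rank two, `φ` the twisted action of one Galois element, `P` its homogenised characteristic polynomial, and
`Δ ∈ S_m` is INDEPENDENT of `j` — whence a bound uniform in the level.)

References: [Howard2004HeegnerKolyvagin] B. Howard, Compositio Math. 140 (2004), §1.3 H.4, §2.2 (the application);
[AtiyahMacdonald1969] M. F. Atiyah, I. G. Macdonald, *Introduction to Commutative Algebra* (1969), Ch. 2 and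
Prop. 6.9 (length/counting over Artinian rings) — folklore linear algebra.
-/

noncomputable section

open Polynomial

universe u v w

namespace Literature.Algebra.Module

/-! ## §1 Eigenvectors are killed by `P(μ)` -/

section Eigen

variable {A : Type u} [CommRing A] {W : Type v} [AddCommGroup W] [Module A W]

/-- If `P(φ) = 0` and `φ w = μ • w` then `P(μ) • w = 0`. [cite: AtiyahMacdonald1969, Ch. 2 (folklore)] -/
theorem eval_smul_eq_zero_of_aeval_eq_zero {φ : Module.End A W} {P : A[X]} (hP : aeval φ P = 0) {μ : A} {w : W}
    (hw : φ w = μ • w) : P.eval μ • w = 0 := by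
  rw [← Module.End.aeval_apply_of_mem_apply_eq_smul hw, hP, LinearMap.zero_apply]

/-- Hence the `μ`-eigenvectors lie in the `P(μ)`-torsion. [cite: AtiyahMacdonald1969, Ch. 2 (folklore)] -/
theorem setOf_apply_eq_smul_subset_torsionBy {φ : Module.End A W} {P : A[X]} (hP : aeval φ P = 0) (μ : A) :
    {w : W | φ w = μ • w} ⊆ (Submodule.torsionBy A W (P.eval μ) : Set W) := fun _ hw ↦
  (Submodule.mem_torsionBy_iff _ _).2 (eval_smul_eq_zero_of_aeval_eq_zero hP hw)

end Eigen

/-! ## §2 Torsion of a free module, coordinatewise -/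

section Free

variable {A : Type u} [CommRing A] {W : Type v} [AddCommGroup W] [Module A W] {ι : Type w} [Fintype ι]

omit [Fintype ι] in
/-- In a free module with basis `b`, `δ • w = 0` iff every coordinate of `w` is killed by `δ`.
[cite: AtiyahMacdonald1969, Ch. 2 (folklore)] -/
theorem smul_eq_zero_iff_forall_repr (b : Module.Basis ι A W) (δ : A) (w : W) :
    δ • w = 0 ↔ ∀ i, δ * b.repr w i = 0 := by
  constructor
  · intro h i
    have := congrArg (fun x ↦ b.repr x i) h
    simpa using this
  · intro h
    apply b.repr.injective
    ext i
    simpa using h i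

/-- **`#W[δ] = #A[δ]^{#ι}`** for `W` free with basis indexed by the finite type `ι`.
[cite: AtiyahMacdonald1969, Ch. 2 (folklore)] -/
theorem natCard_torsionBy_eq_pow (b : Module.Basis ι A W) (δ : A) :
    Nat.card (Submodule.torsionBy A W δ) = Nat.card (Submodule.torsionBy A A δ) ^ Fintype.card ι := by
  classical
  rw [← Nat.card_eq_fintype_card (α := ι), ← Nat.card_fun]
  refine Nat.card_congr ?_
  refine
    { toFun := fun w i ↦ ⟨b.repr w.1 i, (Submodule.mem_torsionBy_iff _ _).2 ?_⟩
      invFun := fun g ↦ ⟨b.repr.symm (Finsupp.equivFunOnFinite.symm fun i ↦ (g i).1),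
        (Submodule.mem_torsionBy_iff _ _).2 ?_⟩
      left_inv := fun w ↦ ?_
      right_inv := fun g ↦ ?_ }
  · rw [smul_eq_mul]
    exact (smul_eq_zero_iff_forall_repr b δ w.1).1 ((Submodule.mem_torsionBy_iff _ _).1 w.2) i
  · rw [smul_eq_zero_iff_forall_repr b δ]
    intro i
    simpa using (Submodule.mem_torsionBy_iff _ _).1 (g i).2
  · apply Subtype.ext
    change b.repr.symm _ = w.1
    rw [LinearEquiv.symm_apply_eq]
    ext i
    simp
  · funext i
    apply Subtype.ext
    simp

/-- **`#{w : φ w = μ w} ≤ #A[P(μ)]^{#ι}`** when `P(φ) = 0` and `W` is free with basis indexed by `ι` and `A[P(μ)]` is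
finite. [cite: AtiyahMacdonald1969, Ch. 2 (folklore)] -/
theorem natCard_setOf_apply_eq_smul_le_pow (b : Module.Basis ι A W) {φ : Module.End A W} {P : A[X]}
    (hP : aeval φ P = 0) (μ : A) [Finite (Submodule.torsionBy A A (P.eval μ))] :
    Nat.card {w : W | φ w = μ • w} ≤ Nat.card (Submodule.torsionBy A A (P.eval μ)) ^ Fintype.card ι := by
  rw [← natCard_torsionBy_eq_pow b]
  haveI : Finite (Submodule.torsionBy A W (P.eval μ)) :=
    Nat.finite_of_card_ne_zero (by
      rw [natCard_torsionBy_eq_pow b]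
      exact pow_ne_zero _ (Nat.card_pos (α := Submodule.torsionBy A A (P.eval μ))).ne')
  exact Nat.card_mono (Set.toFinite _) (setOf_apply_eq_smul_subset_torsionBy hP μ)

end Free

/-! ## §3 Kernel versus cokernel of multiplication by `δ`; passing to a quotient ring -/

section Finite

variable {A : Type u} [CommRing A]

/-- For a module endomorphism of a FINITE module, kernel and cokernel have the same size.
[cite: AtiyahMacdonald1969, Prop. 6.9 (folklore counting)] -/
theorem natCard_quotient_range_eq_natCard_ker {W : Type v} [AddCommGroup W] [Module A W] [Finite W]
    (g : W →ₗ[A] W) : Nat.card (W ⧸ LinearMap.range g) = Nat.card (LinearMap.ker g) := by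
  have h1 := Submodule.card_eq_card_quotient_mul_card (LinearMap.ker g)
  have h2 := Submodule.card_eq_card_quotient_mul_card (LinearMap.range g)
  have h3 : Nat.card (W ⧸ LinearMap.ker g) = Nat.card (LinearMap.range g) := Nat.card_congr g.quotKerEquivRange.toEquiv
  rw [h3] at h1
  have hpos : 0 < Nat.card (LinearMap.range g) := Nat.card_pos
  rw [h1, mul_comm] at h2
  exact (Nat.eq_of_mul_eq_mul_left hpos h2).symm

/-- **`#A[δ] = #(A/(δ))`** for a finite commutative ring. [cite: AtiyahMacdonald1969, Prop. 6.9 (folklore counting)] -/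
theorem natCard_torsionBy_eq_natCard_quotient_span [Finite A] (δ : A) :
    Nat.card (Submodule.torsionBy A A δ) = Nat.card (A ⧸ Ideal.span {δ}) := by
  have hker : LinearMap.ker (LinearMap.toSpanSingleton A A δ) = Submodule.torsionBy A A δ := by
    ext a
    rw [LinearMap.mem_ker, LinearMap.toSpanSingleton_apply, Submodule.mem_torsionBy_iff, smul_eq_mul, smul_eq_mul,
      mul_comm]
  have hrange : LinearMap.range (LinearMap.toSpanSingleton A A δ) = Ideal.span {δ} :=
    (LinearMap.span_singleton_eq_range A A δ).symm
  rw [← hker, ← natCard_quotient_range_eq_natCard_ker, hrange]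

/-- Along a SURJECTIVE ring map `f : S → A`, `A/(f Δ)` is a quotient of `S/(Δ)`: `#(A/(f Δ)) ≤ #(S/(Δ))` when the latter
is finite. [cite: AtiyahMacdonald1969, Ch. 1 (folklore)] -/
theorem natCard_quotient_span_map_le {S : Type v} [CommRing S] (f : S →+* A) (hf : Function.Surjective f) (Δ : S)
    [Finite (S ⧸ Ideal.span {Δ})] : Nat.card (A ⧸ Ideal.span {f Δ}) ≤ Nat.card (S ⧸ Ideal.span {Δ}) := by
  have hle : Ideal.span {Δ} ≤ (Ideal.span {f Δ}).comap f := by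
    rw [Ideal.span_le, Set.singleton_subset_iff, SetLike.mem_coe, Ideal.mem_comap]
    exact Ideal.subset_span rfl
  exact Nat.card_le_card_of_surjective _ (Ideal.quotientMap_surjective (H := hle) hf)

end Finite

/-! ## §4 Assembled bound -/

section Assembled

variable {A : Type u} [CommRing A] {W : Type v} [AddCommGroup W] [Module A W] {ι : Type w} [Fintype ι]

/-- **`#{w : φ w = μ w} ≤ #(S/(Δ))^{#ι}`**: for `A` finite, `W` free over `A` with basis indexed by `ι`, `φ ∈ End_A(W)`
killed by `P ∈ A[X]`, and `Δ ∈ S` mapping to `P(μ)` along a surjection `f : S ↠ A` with `S/(Δ)` finite.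
[cite: Howard2004HeegnerKolyvagin, §1.3 H.4 and §2.2 (the application)] [cite: AtiyahMacdonald1969, Prop. 6.9 (folklore)] -/
theorem natCard_setOf_apply_eq_smul_le_of_surjective [Finite A] (b : Module.Basis ι A W) {φ : Module.End A W}
    {P : A[X]} (hP : aeval φ P = 0) (μ : A) {S : Type v} [CommRing S] (f : S →+* A) (hf : Function.Surjective f)
    (Δ : S) (hΔ : f Δ = P.eval μ) [Finite (S ⧸ Ideal.span {Δ})] :
    Nat.card {w : W | φ w = μ • w} ≤ Nat.card (S ⧸ Ideal.span {Δ}) ^ Fintype.card ι := by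
  haveI : Finite (Submodule.torsionBy A A (P.eval μ)) := inferInstance
  refine (natCard_setOf_apply_eq_smul_le_pow b hP μ).trans (Nat.pow_le_pow_left ?_ _)
  rw [natCard_torsionBy_eq_natCard_quotient_span, ← hΔ]
  exact natCard_quotient_span_map_le f hf Δ


/-- Universe-polymorphic form of `natCard_setOf_apply_eq_smul_le_of_surjective` (the comparison ring `S` in an arbitrary
universe, e.g. `S = S_m = Λ/(T^m + p)` in `Type` while the module lives over a field in `Type u`):
**`#{w : φ w = μ w} ≤ #(S/(Δ))^{#ι}`**. [cite: Howard2004HeegnerKolyvagin, §1.3 H.4 and §2.2 (the application)]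
[cite: AtiyahMacdonald1969, Prop. 6.9 (folklore)] -/
theorem natCard_setOf_apply_eq_smul_le_of_surjective' [Finite A] (b : Module.Basis ι A W) {φ : Module.End A W}
    {P : A[X]} (hP : aeval φ P = 0) (μ : A) {S : Type*} [CommRing S] (f : S →+* A) (hf : Function.Surjective f)
    (Δ : S) (hΔ : f Δ = P.eval μ) [Finite (S ⧸ Ideal.span {Δ})] :
    Nat.card {w : W | φ w = μ • w} ≤ Nat.card (S ⧸ Ideal.span {Δ}) ^ Fintype.card ι := by
  refine (natCard_setOf_apply_eq_smul_le_pow b hP μ).trans (Nat.pow_le_pow_left ?_ _)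
  rw [natCard_torsionBy_eq_natCard_quotient_span, ← hΔ]
  exact natCard_quotient_span_map_le f hf Δ

end Assembled

end Literature.Algebra.Module

end
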